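import Literature.NumberTheory.Rogawski1990.KottwitzSignTwistedFrame                   -- ★ `exists_mul_conjLocal_eq_toLocalRing_iff` (local norm dictionary, CM)
import Literature.NumberTheory.Automorphic.QuadraticLocalNormGroupNonsplit             -- ★ `exists_conjLocal_eq_not_exists_norm` (index 2: a non-norm)
import Literature.NumberTheory.QuadraticForms.HilbertSymbolAtUnramifiedPlace          -- ★ `hilbertSymbol_eq_one_of_even_of_isUnramifiedIn` (O'Meara 63:16)
import Literature.NumberTheory.NumberFields.CMFieldTotallyNegativeGenerator            -- ★ `algebraMap_ne_of_complexConj_eq_neg`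
import HarnessLib

/-!
# Flicker's scalars at a CM place: `½`, a non-norm `π`, `x x̄ = 2`, `y ȳ = −2` in `L ⊗ L⁺_v` at a non-split unramified place `v ∤ 2`
# (Flicker 1998 §2 Prop. 3 p. 79; O'Meara 1963 63:16)

Topic `NumberTheory/Rogawski1990`; namespace `Literature.NumberTheory.Rogawski1990`.  **Theorems only** (no `def`, no instance, no notation, no named
fact, no `sorry`); imports = tree.  Brick (F0) FILE 4 of the road «N7-ns COUNT FROM FLICKER»: the CM DISCHARGE of the scalar hypotheses
`(h2 : 2e = 1) (hσπ : σπ = π) (hπN : ∀ z, σ(z) z ≠ π) (hx : σ(x) x = 2) (hy : σ(y) y = −2)` of ★ FILE 3 `conjClassesIn_flickerTorusElt_eq`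
(Flicker's Prop. 3: `Δ ∈ F − NE`, «since `E∕F` is unramified there is `x ∈ E` with `x x̄ = 2`», «`y ∈ E` such that `y ȳ = −2`»), on the carrier
`UnitaryGroup.LocalRing L v = L ⊗ L⁺_v` with `σ = conjLocal L c v`, at a finite place `v` of `L⁺` non-split and unramified in `L` with `|2|_v = 1`.

* `exists_conjLocal_mul_eq_toLocalRing_of_valued_eq_one` — `|t|_v = 1 ⇒ ι_v t = σ(z) z`: O'Meara 63:16 (★ `hilbertSymbol_eq_one_of_even_of_isUnramifiedIn`,
  `θ = cmQuadraticGenerator L`, `α² = θ`, `α ∉ L⁺` ★ `algebraMap_ne_of_complexConj_eq_neg`) read through ★ `exists_mul_conjLocal_eq_toLocalRing_iff`.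
* **`exists_flicker_scalars_of_nonsplit`** — `∃ e π x y`, `2e = 1`, `σπ = π`, `π` a unit and not a norm (★ `exists_conjLocal_eq_not_exists_norm`, index 2),
  `σ(x) x = 2`, `σ(y) y = −2`.

## References
* Y. Z. Flicker, *Elementary proof of the fundamental lemma for a unitary group*, Canad. J. Math. 50 (1998) 74–98, §2 Prop. 3 p. 79 [Flicker1998UnitaryFL].
* O. T. O'Meara, *Introduction to Quadratic Forms* (1963), §63B Prop. 63:13, §63C Example 63:16 [Omeara1963].
-/

set_option autoImplicit false

noncomputable section

open NumberField IsDedekindDomain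
open scoped MatrixGroups

namespace Literature.NumberTheory.Rogawski1990

open Literature.NumberTheory.Automorphic Literature.NumberTheory.Automorphic.UnitaryGroup
open Literature.NumberTheory.QuadraticForms Literature.NumberTheory.NumberFields

variable (L : Type) [Field L] [NumberField L] [IsCMField L] (v : HeightOneSpectrum (𝓞 ↥(maximalRealSubfield L)))

/-- **A unit of `L⁺_v` of valuation `1` is a local norm at an unramified place**: for `t ∈ L⁺_v` with `|t|_v = 1` there is `z ∈ L ⊗ L⁺_v` with
`σ(z) z = ι_v t` — O'Meara's «at an unramified place the norms are the elements of even order» (★ `hilbertSymbol_eq_one_of_even_of_isUnramifiedIn`)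
read through the local norm dictionary (★ `exists_mul_conjLocal_eq_toLocalRing_iff`). [cite: Omeara1963, §63C Example 63:16] [cite: Flicker1998UnitaryFL, §2 Prop. 3 p. 79] -/
theorem exists_conjLocal_mul_eq_toLocalRing_of_valued_eq_one (hunr : Algebra.IsUnramifiedIn (𝓞 L) v.asIdeal)
    {t : v.adicCompletion ↥(maximalRealSubfield L)} (ht : Valued.v t = 1) :
    ∃ z : UnitaryGroup.LocalRing L v, UnitaryGroup.conjLocal L (IsCMField.complexConj L) v z * z = UnitaryGroup.toLocalRing L v t := by
  have ht0 : t ≠ 0 := fun h => by rw [h, map_zero] at ht; exact zero_ne_one ht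
  haveI : CharZero (v.adicCompletion ↥(maximalRealSubfield L)) :=
    charZero_of_injective_algebraMap (algebraMap (↥(maximalRealSubfield L)) _).injective
  haveI : NeZero (2 : v.adicCompletion ↥(maximalRealSubfield L)) := ⟨two_ne_zero⟩
  obtain ⟨α, hα0, hcα, hsq⟩ := cmQuadraticGenerator_spec L
  have hθ0 : algebraMap (↥(maximalRealSubfield L)) (v.adicCompletion ↥(maximalRealSubfield L))
      (cmQuadraticGenerator L : ↥(maximalRealSubfield L)) ≠ 0 := by
    rw [map_ne_zero]
    intro h
    rw [h, map_zero, sq_eq_zero_iff] at hsq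
    exact hα0 hsq
  have heven : Even (WithZero.log (Valued.v t)) := by rw [ht, WithZero.log_one]; exact Even.zero
  have hsym := hilbertSymbol_eq_one_of_even_of_isUnramifiedIn ↥(maximalRealSubfield L) v hsq (algebraMap_ne_of_complexConj_eq_neg hcα hα0) hunr ht0
    heven
  have hmem := (hilbertSymbol_eq_one_iff_mem_quadraticNormSubgroup hθ0 (Units.mk0 t ht0)).1 (by rw [Units.val_mk0]; exact hsym)
  obtain ⟨z, hz⟩ := (exists_mul_conjLocal_eq_toLocalRing_iff v (Units.mk0 t ht0)).2 hmem
  exact ⟨z, by rw [mul_comm, hz, Units.val_mk0]⟩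

/-- **FLICKER'S SCALARS AT A CM PLACE.**  At a finite place `v` of `L⁺` non-split and unramified in `L` with `|2|_v = 1` (Flicker's standing `p ≠ 2`), the
ring `L ⊗ L⁺_v` (`= L_w`, a field) contains `e` with `2e = 1`, a `σ`-fixed unit `π` which is NOT a norm `σ(z) z` (index `[L⁺_vˣ : N] = 2`, ★
`exists_conjLocal_eq_not_exists_norm`), and `x, y` with `σ(x) x = 2`, `σ(y) y = −2` (units are norms, unramified) — the scalar hypotheses
`h2, hσπ, hπN, hx, hy` of ★ `conjClassesIn_flickerTorusElt_eq` (Flicker's Prop. 3: «since `E∕F` is unramified, there is `x ∈ E` with `x x̄ = 2`»,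
«`y ∈ E` such that `y ȳ = −2`», `Δ ∈ F − NE`). [cite: Flicker1998UnitaryFL, §2 Prop. 3 p. 79] [cite: Omeara1963, §63C Example 63:16; §63B Prop. 63:13] -/
theorem exists_flicker_scalars_of_nonsplit (w : PlacesOver L v) (hw : IsCMField.complexConj L • w.1 = w.1)
    (hunr : Algebra.IsUnramifiedIn (𝓞 L) v.asIdeal) (h2 : Valued.v (2 : v.adicCompletion ↥(maximalRealSubfield L)) = 1) :
    ∃ e π x y : UnitaryGroup.LocalRing L v,
      2 * e = 1 ∧ UnitaryGroup.conjLocal L (IsCMField.complexConj L) v π = π ∧ IsUnit π ∧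
        (∀ z, UnitaryGroup.conjLocal L (IsCMField.complexConj L) v z * z ≠ π) ∧
        UnitaryGroup.conjLocal L (IsCMField.complexConj L) v x * x = 2 ∧ UnitaryGroup.conjLocal L (IsCMField.complexConj L) v y * y = -2 := by
  haveI : Algebra.IsQuadraticExtension ↥(maximalRealSubfield L) L := IsCMField.isQuadraticExtension L
  haveI : CharZero (v.adicCompletion ↥(maximalRealSubfield L)) :=
    charZero_of_injective_algebraMap (algebraMap (↥(maximalRealSubfield L)) _).injective
  obtain ⟨α, hα0, hcα, -⟩ := cmQuadraticGenerator_spec L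
  -- `e = ι_v(½)`
  have h20 : (2 : v.adicCompletion ↥(maximalRealSubfield L)) ≠ 0 := two_ne_zero
  have he : (2 : UnitaryGroup.LocalRing L v) * UnitaryGroup.toLocalRing L v (2⁻¹ : v.adicCompletion ↥(maximalRealSubfield L)) = 1 := by
    rw [← map_ofNat (UnitaryGroup.toLocalRing L v) 2, ← map_mul, mul_inv_cancel₀ h20, map_one]
  -- a non-norm `π`
  obtain ⟨π, hσπ, hπu, hπN⟩ := exists_conjLocal_eq_not_exists_norm L v (IsCMField.complexConj L) hcα hα0 w hw
  have hπN' : ∀ z, UnitaryGroup.conjLocal L (IsCMField.complexConj L) v z * z ≠ π := by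
    intro z hz
    refine hπN ⟨z, ?_, hz.symm⟩
    have hu : IsUnit (UnitaryGroup.conjLocal L (IsCMField.complexConj L) v z * z) := by rw [hz]; exact hπu
    exact isUnit_of_mul_isUnit_right hu
  -- `x x̄ = 2`, `y ȳ = −2`
  have hm2 : Valued.v (-2 : v.adicCompletion ↥(maximalRealSubfield L)) = 1 := by rw [Valuation.map_neg, h2]
  obtain ⟨x, hx⟩ := exists_conjLocal_mul_eq_toLocalRing_of_valued_eq_one L v hunr h2
  obtain ⟨y, hy⟩ := exists_conjLocal_mul_eq_toLocalRing_of_valued_eq_one L v hunr hm2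
  rw [map_ofNat] at hx
  rw [map_neg, map_ofNat] at hy
  exact ⟨_, π, x, y, he, hσπ, hπu, hπN', hx, hy⟩

end Literature.NumberTheory.Rogawski1990
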